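import Summits.QuantumAdvantage.QuantumAdvantage.Theorems.CertDialI
import HarnessLib

/-!
# CertDial — part J (§12): A PERIOD-4 AFFINE STRATEGY BEATS WEIGHT THREE WHEN `4 ∣ n` — the affine corner closed

Parts H/I: weight 3 is won by the affine XOR-antipode at `n ≡ 2 (mod 4)` and by the quadratic OR-antipode at `n ≡ 0 (mod 4)`;
numerically no covariant or period-2 AFFINE junta on the near/antipodal reads is perfect to 3 when `4 ∣ n` (g28 `num/affmitm.py`,
exhaustive at `n = 12, 16, 20`).  A meet-in-the-middle search found the way out: PERIOD FOUR.  With `u = x_{b+1}`, `v = x_{b+n/2+1}`: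
on the positions `b ≡ t, t−1 (mod 4)` play `T₁ = 1 + X_b + 2X_{b+1} + 2X_{b+n/2+1}` (answer `x_b ? u ⊕ v : ¬(u ∨ v)`), elsewhere
`T₂ = 1 + X_{b+1} + X_{b+n/2+1}` (answer `¬(u ∨ v)`).  So the answer is `NOR(u,v) ⊕ [b ∈ C_t ∧ x_b ∧ NAND(u,v)]`, and mod 2 the
count of `rel_mono_iff` / `rel_tri_iff` is `|E| − (OR count of part I) + (a term supported on the input)`: the OR counts are exactly the
ones certified for `orAnti` in part I, `|E|` is `n/2` resp. `n/2 + d/2`, and the input term is `[0 ∈ C_t] + [d ∈ C_t]`, which has the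
parity of `d/2` for every class offset `t` — so every `p4Anti t` wins every odd-class input of weight `≤ 3` when `4 ∣ n`
(`p4Anti_perfect_three`).  Consequently the per-length clause of the weight-3 leaf `PGlobalFail 2 D 3` fails at EVERY even `n ≥ 12`
for EVERY `D ≥ 1` (`weightThree_leaf_fails_everywhere'`, `affine_generic_perfect_three`).
READING for the lineage: the weight-3 storey of the dial is now completely mapped for generic strategies (affine suffices at every even
length; covariance fails exactly when `4 ∣ n`, where period 4 is used); nothing here touches the weight-7 leaves or 27432.
`lean check` on the tree closure: rc 0, no warnings, no placeholders; axioms standard (`propext`, `Classical.choice`, `Quot.sound`).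
-/

set_option linter.dupNamespace false
set_option linter.style.longLine false

noncomputable section
open scoped Classical

namespace Summit.QuantumAdvantage.QuantumAdvantage.Theorems.CertDial
open Finset
open Literature.Computability.QuantumComplexity Literature.Computability.QuantumComplexity.RingHLF
open Summit.QuantumAdvantage.AdviceFreeQNC0
open Literature.Computability.MetaComplexity Literature.Computability.MetaComplexity.Smolensky
open Summit.QuantumAdvantage.QuantumAdvantage.Theorems.LightDial (wt ind onesOf ind_onesOf wt_eq_card_onesOf oddZeros_ind_iff
  mono_singleton_apply)
open Summit.QuantumAdvantage.QuantumAdvantage.Theorems.ParityDial (par offs IsParityLocal PGlobalFail)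
open Summit.QuantumAdvantage.AdviceFreeQNC0.LightConeWindowHard (window window_apply)
open Summit.QuantumAdvantage.AdviceFreeQNC0.RingSymmetry (shift rot_apply rel_rot card_filter_shift shift_shift)

variable {n : ℕ}

/-! ### §12a Counting tools: NOR counts, the size of the two electorates -/

/-- a NOR count is the electorate minus the OR count. -/
theorem card_nor_add (E : Fin n → Prop) [DecidablePred E] (u v : Fin n → Bool) :
    (univ.filter fun b : Fin n => E b ∧ (!(u b || v b)) = true).card + (univ.filter fun b : Fin n => E b ∧ (u b || v b) = true).card =
      (univ.filter fun b : Fin n => E b).card := by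
  have h : ∀ b : Fin n, ((if E b ∧ (!(u b || v b)) = true then 1 else 0) + (if E b ∧ (u b || v b) = true then 1 else 0) : ℕ) =
      (if E b then 1 else 0) := by
    intro b
    by_cases hE : E b <;> cases hu : u b <;> cases hv : v b <;> simp [hE]
  have hs := Finset.sum_congr rfl fun b (_ : b ∈ (univ : Finset (Fin n))) => h b
  rw [Finset.sum_add_distrib, ← Finset.card_filter, ← Finset.card_filter, ← Finset.card_filter] at hs
  exact hs

/-- counting ring positions by a property of their value = counting in `range n` (cf. the `Iio` form `Coset21.card_filter_val`). -/
theorem card_filter_range (P : ℕ → Prop) [DecidablePred P] :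
    (univ.filter fun b : Fin n => P b).card = ((Finset.range n).filter P).card := by
  rw [Finset.card_filter, Finset.card_filter, Fin.sum_univ_eq_sum_range (fun i => if P i then 1 else 0) n]

/-- the number of `i < N` of parity different from `q`. -/
theorem card_range_par_ne (q : Bool) (N : ℕ) :
    ((Finset.range N).filter fun i => decide (i % 2 = 0) ≠ q).card = if q = true then N / 2 else (N + 1) / 2 := by
  induction N with
  | zero => simp
  | succ N ih =>
    rw [Finset.range_add_one, Finset.filter_insert]
    have hN : N ∉ (Finset.range N).filter (fun i => decide (i % 2 = 0) ≠ q) := by simp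
    by_cases hP : decide (N % 2 = 0) ≠ q
    · rw [if_pos hP, card_insert_of_notMem hN, ih]
      cases q
      · simp only [ne_eq, decide_eq_false_iff_not, not_not] at hP; simp only [Bool.false_eq_true, if_false]; omega
      · simp only [ne_eq, decide_eq_true_eq] at hP; simp only [if_true]; omega
    · rw [if_neg hP, ih]
      cases q
      · simp only [ne_eq, decide_eq_false_iff_not, not_not] at hP; simp only [Bool.false_eq_true, if_false]; omega
      · simp only [ne_eq, decide_eq_true_eq, not_not] at hP; simp only [if_true]; omega

/-- a parity class of the even ring has `n/2` positions. -/
theorem card_par_ne (he : n % 2 = 0) (q : Bool) : (univ.filter fun b : Fin n => par b ≠ q).card = n / 2 := by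
  have h := card_filter_range (n := n) (fun i => decide (i % 2 = 0) ≠ q)
  simp only [par] at h ⊢
  rw [h, card_range_par_ne]
  cases q
  · simp only [Bool.false_eq_true, if_false]; omega
  · simp only [if_true]

/-- the number of `i < N` that are even or below `d` (`d` even, `d ≤ N`). -/
theorem card_range_electorate {d : ℕ} (hd2 : d % 2 = 0) : ∀ N : ℕ, d ≤ N →
    ((Finset.range N).filter fun i => i % 2 = 0 ∨ i < d).card = d + (N - d + 1) / 2 := by
  intro N hN
  induction N with
  | zero => simp; omega
  | succ N ih =>
    rw [Finset.range_add_one, Finset.filter_insert]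
    have hmem : N ∉ (Finset.range N).filter (fun i => i % 2 = 0 ∨ i < d) := by simp
    rcases Nat.lt_or_ge N d with hlt | hge
    · -- then `N + 1 = d`... impossible unless `d = N + 1`; but `d ≤ N + 1` and `N < d` force `d = N + 1`
      have hdN : d = N + 1 := by omega
      subst hdN
      rw [if_pos (Or.inr (by omega)), card_insert_of_notMem hmem]
      have hall : ((Finset.range N).filter fun i => i % 2 = 0 ∨ i < N + 1) = Finset.range N :=
        Finset.filter_true_of_mem fun i hi => Or.inr (by rw [Finset.mem_range] at hi; omega)
      rw [hall, Finset.card_range]; omega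
    · have ih' := ih hge
      by_cases hP : N % 2 = 0 ∨ N < d
      · rw [if_pos hP, card_insert_of_notMem hmem, ih']; omega
      · rw [if_neg hP, ih']; omega

/-- the electorate `E ∪ [0,d)` of the two-one law has `n/2 + d/2` positions (`n`, `d` even, `d ≤ n`). -/
theorem card_electorate (he : n % 2 = 0) {d : ℕ} (hd2 : d % 2 = 0) (hdn : d ≤ n) :
    (univ.filter fun b : Fin n => (b : ℕ) % 2 = 0 ∨ (b : ℕ) < d).card = n / 2 + d / 2 := by
  rw [card_filter_range (fun i => i % 2 = 0 ∨ i < d), card_range_electorate hd2 n hdn]; omega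

/-! ### §12b The period-4 affine strategy -/

/-- table `T₂ = 1 + X_{b+1} + X_{b+n/2+1}` (affine; answer `¬(x_{b+1} ∨ x_{b+n/2+1})`). -/
def tNor (n : ℕ) (b : Fin n) : CubeFn (ZMod 3) n :=
  1 + mono (ZMod 3) ({shift n 1 b} : Finset (Fin n)) + mono (ZMod 3) ({shift n (1 + n / 2) b} : Finset (Fin n))

/-- table `T₁ = 1 + X_b + 2X_{b+1} + 2X_{b+n/2+1}` (affine; answer `x_b ? (x_{b+1} ⊕ x_{b+n/2+1}) : ¬(x_{b+1} ∨ x_{b+n/2+1})`). -/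
def tMix (n : ℕ) (b : Fin n) : CubeFn (ZMod 3) n :=
  1 + mono (ZMod 3) ({b} : Finset (Fin n)) + (2 : ZMod 3) • mono (ZMod 3) ({shift n 1 b} : Finset (Fin n)) +
    (2 : ZMod 3) • mono (ZMod 3) ({shift n (1 + n / 2) b} : Finset (Fin n))

/-- the class `C_t = {b ≡ t} ∪ {b ≡ t − 1} (mod 4)` on which `T₁` is played. -/
def inC (t : ℕ) (b : Fin n) : Bool := decide ((b : ℕ) % 4 = t % 4 ∨ ((b : ℕ) + 1) % 4 = t % 4)

/-- ★ the PERIOD-4 AFFINE strategy with class offset `t`: `T₁` on `C_t`, `T₂` elsewhere. -/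
def p4Anti (t n : ℕ) : Fin n → CubeFn (ZMod 3) n := fun b => if inC t b = true then tMix n b else tNor n b

/-- it is AFFINE. -/
theorem p4Anti_mem (t : ℕ) (b : Fin n) : p4Anti t n b ∈ lowDeg (ZMod 3) n 1 := by
  unfold p4Anti tMix tNor
  split_ifs
  · exact Submodule.add_mem _ (Submodule.add_mem _ (Submodule.add_mem _ (one_mem_lowDeg 1) (mono_singleton_mem _))
      (Submodule.smul_mem _ _ (mono_singleton_mem _))) (Submodule.smul_mem _ _ (mono_singleton_mem _))
  · exact Submodule.add_mem _ (Submodule.add_mem _ (one_mem_lowDeg 1) (mono_singleton_mem _)) (mono_singleton_mem _)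

/-- its answer bit: `NOR(u,v) ⊕ [b ∈ C_t ∧ x_b ∧ NAND(u,v)]` with `u = x_{b+1}`, `v = x_{b+n/2+1}`. -/
theorem p4Anti_eq_one_iff (t : ℕ) (b : Fin n) (x : Fin n → Bool) :
    p4Anti t n b x = 1 ↔ ((!(x (shift n 1 b) || x (shift n (1 + n / 2) b))) ^^
      (inC t b && (x b && !(x (shift n 1 b) && x (shift n (1 + n / 2) b))))) = true := by
  unfold p4Anti tMix tNor
  cases hc : inC t b <;> simp only [if_true, if_false, Bool.false_eq_true, Pi.add_apply, Pi.smul_apply, Pi.one_apply, smul_eq_mul,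
      mono_singleton_apply] <;>
    cases x b <;> cases x (shift n 1 b) <;> cases x (shift n (1 + n / 2) b) <;> decide

/-- its answer map. -/
theorem ans_p4Anti (t : ℕ) (x : Fin n → Bool) : ans (p4Anti t n) x = fun b => (!(x (shift n 1 b) || x (shift n (1 + n / 2) b))) ^^
      (inC t b && (x b && !(x (shift n 1 b) && x (shift n (1 + n / 2) b)))) := by
  funext b
  unfold ans
  rw [Bool.eq_iff_iff, decide_eq_true_eq]
  exact p4Anti_eq_one_iff t b x

/-- the class test after a rotation (`4 ∣ n`): `shift k b ∈ C_t ↔ b ∈ C_{t + 3k}`. -/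
theorem inC_shift (h4 : n % 4 = 0) (t k : ℕ) (b : Fin n) : inC t (shift n k b) = inC (t + 3 * k) b := by
  have hb := b.isLt
  have hdvd : 4 ∣ n := Nat.dvd_of_mod_eq_zero h4
  simp only [inC, val_shift, decide_eq_decide]
  have e1 : ((b : ℕ) + k) % n % 4 = ((b : ℕ) + k) % 4 := Nat.mod_mod_of_dvd _ hdvd
  omega

/-- `C_{t + 4k} = C_t`. -/
theorem inC_add_four_mul (t k : ℕ) (b : Fin n) : inC (t + 4 * k) b = inC t b := by
  simp [inC, Nat.add_mul_mod_self_left]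

/-- rotation equivariance UP TO THE CLASS OFFSET (`4 ∣ n`): rotating the input by `k` turns `p4Anti t` into `p4Anti (t + k)`. -/
theorem p4Anti_equivariant (h4 : n % 4 = 0) (t k : ℕ) (x : Fin n → Bool) :
    ans (p4Anti t n) (rot k x) = rot k (ans (p4Anti (t + k) n) x) := by
  rw [ans_p4Anti, ans_p4Anti]
  funext b
  simp only [rot_apply, shift_shift, inC_shift h4]
  rw [show t + k + 3 * k = t + 4 * k by ring, inC_add_four_mul, Nat.add_comm k 1, Nat.add_comm k (1 + n / 2)]

/-! ### §12c It wins every light input when `4 ∣ n`, for every class offset -/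

/-- the input-supported correction term vanishes on inputs avoiding the electorate (monochromatic case). -/
theorem card_extra_mono {x : Fin n → Bool} {q : Bool} (hq : ∀ b, x b = true → par b = q) (t : ℕ) (w : Fin n → Bool) :
    (univ.filter fun b : Fin n => par b ≠ q ∧ (inC t b && (x b && w b)) = true).card = 0 := by
  refine Finset.card_eq_zero.mpr (Finset.filter_eq_empty_iff.mpr fun b _ h => ?_)
  simp only [Bool.and_eq_true] at h
  exact h.1 (hq b h.2.2.1)

/-- MONOCHROMATIC odd-class inputs (any weight) are won by every `p4Anti t` when `4 ∣ n`: the NOR count is `n/2` minus the (even, part I)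
OR count, and the correction term is empty. -/
theorem p4Anti_wins_mono (h4 : n % 4 = 0) (hn : 4 ≤ n) (t : ℕ) {x : Fin n → Bool} (hx : OddZeros x) {q : Bool}
    (hq : ∀ b, x b = true → par b = q) : Rel x (ans (p4Anti t n) x) := by
  have he : n % 2 = 0 := by omega
  have hor := (rel_mono_iff he (by omega) hx hq _).1 (orAnti_wins_mono h4 (by omega) hx hq)
  rw [ans_orAnti] at hor
  beta_reduce at hor
  rw [rel_mono_iff he (by omega) hx hq, ans_p4Anti, card_xor_mod_two (fun b : Fin n => par b ≠ q), card_extra_mono hq]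
  have hnor := card_nor_add (fun b : Fin n => par b ≠ q) (fun b => x (shift n 1 b)) (fun b => x (shift n (1 + n / 2) b))
  rw [card_par_ne he] at hnor
  omega

/-- the correction term on the two-one input `1_{0,d,e}`: it fires at `0` iff `0 ∈ C_t` and at `d` iff `d ∈ C_t` (the NAND factor is on,
the position `e` is outside the electorate; `4 ∣ n`). -/
theorem card_extra_tri (h4 : n % 4 = 0) (t : ℕ) {d e : ℕ} (hd2 : d % 2 = 0) (he2 : e % 2 = 1) (hd : 2 ≤ d) (hde : d < e) (hen : e < n) :
    (univ.filter fun b : Fin n => ((b : ℕ) % 2 = 0 ∨ (b : ℕ) < d) ∧ (inC t b && (tri n d e b &&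
        !(tri n d e (shift n 1 b) && tri n d e (shift n (1 + n / 2) b)))) = true).card =
      (if inC t (⟨0, by omega⟩ : Fin n) = true then 1 else 0) + (if inC t (⟨d, by omega⟩ : Fin n) = true then 1 else 0) := by
  have hcg : (univ.filter fun b : Fin n => ((b : ℕ) % 2 = 0 ∨ (b : ℕ) < d) ∧ (inC t b && (tri n d e b &&
        !(tri n d e (shift n 1 b) && tri n d e (shift n (1 + n / 2) b)))) = true) =
      (univ.filter fun b : Fin n => ((((b : ℕ) % 2 = 0 ∨ (b : ℕ) < d) ∧ inC t b = true ∧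
        (!(tri n d e (shift n 1 b) && tri n d e (shift n (1 + n / 2) b))) = true) ∧ tri n d e b = true)) := by
    refine Finset.filter_congr fun b _ => ?_
    simp only [Bool.and_eq_true]
    exact ⟨fun h => ⟨⟨h.1, h.2.1, h.2.2.2⟩, h.2.2.1⟩, fun h => ⟨h.1.1, h.1.2.1, h.2, h.1.2.2⟩⟩
  rw [hcg, card_filter_and_tri _ (by omega) hde hen]
  -- the NAND factors
  have n0 : (tri n d e (shift n 1 (⟨0, by omega⟩ : Fin n)) && tri n d e (shift n (1 + n / 2) ⟨0, by omega⟩)) = false := by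
    rw [Bool.and_eq_false_iff]; left
    simp only [tri, val_shift]
    exact decide_eq_false (by rw [Nat.zero_add, Nat.mod_eq_of_lt (by omega)]; omega)
  have nd : (tri n d e (shift n 1 (⟨d, by omega⟩ : Fin n)) && tri n d e (shift n (1 + n / 2) ⟨d, by omega⟩)) = false := by
    rw [Bool.and_eq_false_iff]
    simp only [tri, val_shift]
    by_cases hed : e = d + 1
    · right
      refine decide_eq_false ?_
      by_cases hw : d + (1 + n / 2) < n
      · rw [Nat.mod_eq_of_lt hw]; omega
      · rw [show d + (1 + n / 2) = (d + 1 + n / 2 - n) + n by omega, Nat.add_mod_right, Nat.mod_eq_of_lt (by omega)]; omega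
    · left
      exact decide_eq_false (by rw [Nat.mod_eq_of_lt (by omega)]; omega)
  have fd : d % 2 = 0 ∨ d < d := Or.inl hd2
  have fe : ¬ (e % 2 = 0 ∨ e < d) := by omega
  simp only [n0, nd, fd, fe, Bool.not_false, true_or, true_and, and_true, false_and, if_false, add_zero]

/-- the normalised TWO-ONE input `1_{0,d,e}` is won by every `p4Anti t` when `4 ∣ n`: the NOR count is `n/2 + d/2` minus the (odd, part I)
OR count, and the correction `[0 ∈ C_t] + [d ∈ C_t]` has the parity of `d/2` for every `t`. -/
theorem p4Anti_wins_tri (h4 : n % 4 = 0) (t : ℕ) {d e : ℕ} (hd2 : d % 2 = 0) (he2 : e % 2 = 1) (hd : 2 ≤ d) (hde : d < e)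
    (hen : e < n) : Rel (tri n d e) (ans (p4Anti t n) (tri n d e)) := by
  have he : n % 2 = 0 := by omega
  have hn : 3 ≤ n := by omega
  have hor := (rel_tri_iff he hn hd2 he2 hd hde hen _).1 (orAnti_wins_tri h4 hd2 he2 hd hde hen)
  rw [ans_orAnti] at hor
  beta_reduce at hor
  rw [rel_tri_iff he hn hd2 he2 hd hde hen, ans_p4Anti, card_xor_mod_two (fun b : Fin n => (b : ℕ) % 2 = 0 ∨ (b : ℕ) < d),
    card_extra_tri h4 t hd2 he2 hd hde hen]
  have hnor := card_nor_add (fun b : Fin n => (b : ℕ) % 2 = 0 ∨ (b : ℕ) < d) (fun b => tri n d e (shift n 1 b))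
    (fun b => tri n d e (shift n (1 + n / 2) b))
  rw [card_electorate he hd2 (by omega)] at hnor
  by_cases h0 : inC t (⟨0, by omega⟩ : Fin n) = true <;> by_cases hd4 : inC t (⟨d, by omega⟩ : Fin n) = true <;>
    simp only [h0, hd4, if_true, if_false, Bool.false_eq_true] <;>
    simp only [inC, decide_eq_true_eq, not_or] at h0 hd4 <;> omega

/-- … hence every two-one input in general position, for every class offset (equivariance up to the offset). -/
theorem p4Anti_wins_triAt (h4 : n % 4 = 0) (t : ℕ) (i : Fin n) {d e : ℕ} (hd2 : d % 2 = 0) (he2 : e % 2 = 1) (hd : 2 ≤ d)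
    (hde : d < e) (hen : e < n) : Rel (triAt i d e) (ans (p4Anti t n) (triAt i d e)) := by
  rw [triAt_eq_rot, p4Anti_equivariant h4, rel_rot]
  exact p4Anti_wins_tri h4 _ hd2 he2 hd hde hen

/-- ★★★ PERIOD FOUR BEATS WEIGHT THREE, AFFINELY: for `4 ∣ n`, `n ≥ 4`, every `p4Anti t` wins EVERY odd-class input of weight `≤ 3`. -/
theorem p4Anti_perfect_three (h4 : n % 4 = 0) (hn : 4 ≤ n) (t : ℕ) {x : Fin n → Bool} (hx : OddZeros x) (hw : LightDial.wt x ≤ 3) :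
    Rel x (ans (p4Anti t n) x) := by
  rcases light_three_cases (by omega) hx hw with ⟨q, hq⟩ | ⟨i, d, e, hd2, he2, hd, hde, hen, rfl⟩
  · exact p4Anti_wins_mono h4 hn t hx hq
  · exact p4Anti_wins_triAt h4 t i hd2 he2 hd hde hen

/-! ### §12d It is generic; the affine corner of the weight-3 leaf -/

/-- `p4Anti t` is NOT parity-local of radius `2` (`4 ∣ n`, `n ≥ 12`): on `e_{n/2+1}` positions `0` and `2` see empty windows and answer
`0` resp. `1` (the NOR factor), whatever `t`. -/
theorem p4Anti_not_parityLocal (h4 : n % 4 = 0) (hn : 12 ≤ n) (t : ℕ) : ¬ IsParityLocal 2 (p4Anti t n) := by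
  intro hP
  have h0 : 0 < n := by omega
  have h2 : 2 < n := by omega
  have hw : window 2 (lightPt n (1 + n / 2)) ⟨0, h0⟩ = window 2 (lightPt n (1 + n / 2)) ⟨2, h2⟩ := by
    funext d
    have hd := d.isLt
    rw [window_apply 2 (by omega), window_apply 2 (by omega)]
    simp only [lightPt, decide_eq_decide]
    split_ifs <;> omega
  have x0 : lightPt n (1 + n / 2) ⟨0, h0⟩ = false := by simp only [lightPt]; exact decide_eq_false (by omega)
  have x1 : lightPt n (1 + n / 2) (shift n 1 ⟨0, h0⟩) = false := by
    simp only [lightPt, val_shift]; exact decide_eq_false (by rw [Nat.mod_eq_of_lt (by omega)]; omega)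
  have x2 : lightPt n (1 + n / 2) (shift n (1 + n / 2) ⟨0, h0⟩) = true := by
    simp only [lightPt, val_shift]; exact decide_eq_true (by rw [Nat.mod_eq_of_lt (by omega)]; omega)
  have x3 : lightPt n (1 + n / 2) (shift n 1 ⟨2, h2⟩) = false := by
    simp only [lightPt, val_shift]; exact decide_eq_false (by rw [Nat.mod_eq_of_lt (by omega)]; omega)
  have x4 : lightPt n (1 + n / 2) (shift n (1 + n / 2) ⟨2, h2⟩) = false := by
    simp only [lightPt, val_shift]; exact decide_eq_false (by rw [Nat.mod_eq_of_lt (by omega)]; omega)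
  have x5 : lightPt n (1 + n / 2) ⟨2, h2⟩ = false := by simp only [lightPt]; exact decide_eq_false (by omega)
  have key := (hP (lightPt n (1 + n / 2)) ⟨0, h0⟩ ⟨2, h2⟩ (by simp [par]) hw).2
  rw [p4Anti_eq_one_iff, p4Anti_eq_one_iff, x0, x1, x2, x3, x4, x5] at key
  simp at key

/-- ★★★ AFFINE AND GENERIC AT EVERY EVEN LENGTH `n ≥ 12`: `xorAnti` when `n ≡ 2 (mod 4)` (part H), `p4Anti 0` when `4 ∣ n`. -/
theorem affine_generic_perfect_three (he : n % 2 = 0) (hn : 12 ≤ n) :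
    ∃ P : Fin n → CubeFn (ZMod 3) n, (∀ i, P i ∈ lowDeg (ZMod 3) n 1) ∧ ¬ IsParityLocal 2 P ∧
      ∀ x : Fin n → Bool, OddZeros x → LightDial.wt x ≤ 3 → Rel x (ans P x) := by
  by_cases h4 : n % 4 = 0
  · exact ⟨p4Anti 0 n, p4Anti_mem 0, p4Anti_not_parityLocal h4 hn 0, fun x hx hw => p4Anti_perfect_three h4 (by omega) 0 hx hw⟩
  · have h4' : n % 4 = 2 := by omega
    exact ⟨xorAnti n, xorAnti_mem, xorAnti_not_parityLocal h4' (by omega), fun x hx hw => xorAnti_perfect_three h4' (by omega) hx hw⟩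

/-- ★★★ THE WEIGHT-3 LEAF FAILS LENGTH BY LENGTH: the per-length clause of `ParityDial.PGlobalFail 2 D 3` is false at EVERY even `n ≥ 12` for
EVERY degree bound `D ≥ 1` (part I had `D ≥ 2`; the affine corner `D = 1`, `4 ∣ n` is the period-4 strategy). -/
theorem weightThree_leaf_fails_everywhere' (he : n % 2 = 0) (hn : 12 ≤ n) {D : ℕ} (hD : 1 ≤ D) :
    ¬ (∀ P : Fin n → CubeFn (ZMod 3) n, (∀ i, P i ∈ lowDeg (ZMod 3) n D) → ¬ IsParityLocal 2 P →
        ∃ x : Fin n → Bool, OddZeros x ∧ LightDial.wt x ≤ 3 ∧ ¬ Rel x (fun i => decide (P i x = 1))) := by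
  intro h
  obtain ⟨P, hP, hgen, hwin⟩ := affine_generic_perfect_three he hn
  obtain ⟨x, hx, hw, hrel⟩ := h P (fun i => lowDeg_mono hD (hP i)) hgen
  exact hrel (hwin x hx hw)

/-! ### Axiom audit -/

/-- info: 'Summit.QuantumAdvantage.QuantumAdvantage.Theorems.CertDial.p4Anti_perfect_three' depends on axioms: [propext,
 Classical.choice,
 Quot.sound] -/
#guard_msgs in #print axioms p4Anti_perfect_three

/-- info: 'Summit.QuantumAdvantage.QuantumAdvantage.Theorems.CertDial.affine_generic_perfect_three' depends on axioms: [propext,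
 Classical.choice,
 Quot.sound] -/
#guard_msgs in #print axioms affine_generic_perfect_three

/-- info: 'Summit.QuantumAdvantage.QuantumAdvantage.Theorems.CertDial.weightThree_leaf_fails_everywhere'' depends on axioms: [propext,
 Classical.choice,
 Quot.sound] -/
#guard_msgs in #print axioms weightThree_leaf_fails_everywhere'

end Summit.QuantumAdvantage.QuantumAdvantage.Theorems.CertDial
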